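import Literature.Probability.Percolation.IntPairCutCore
import Literature.Probability.Percolation.TrapPairCut
import HarnessLib

/-!
# The inner pair step: a site of an arm is not a cut (twin of `TrapPairCut.lean`)

Topic `Literature/Probability/Percolation`; family `crit-perc` / near-critical percolation on `𝕋`.
A brick of the INNER half of the near-critical arm-separation theorem for four arms in the ADJACENT
colour arrangement (P. Nolin, EJP 13 (2008), Thm. 11, `j = 4`, `σ = BBWW` [arXiv 0711.4948:
Thm. 10], §4.4 Lemma 15, internal extremities, last paragraph of the proof). Word-for-word twin of
`TrapPairCut.lean` in the setting `IntPairData` (`PairData.fin2_eq_of_ne` is reused): `b_far_box`, `attach_geom`,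
`prefix_disjoint_earlier`, `exists_entry_goodSet`, `exists_comp_goodSet`, `not_isCut_of_mem_arm`.

Everything here is proved; no named facts are introduced.

## References

* P. Nolin, Near-critical percolation in two dimensions, *Electron. J. Probab.* 13 (2008), §4.4,
  proof of Lemma 15, internal extremities (arXiv 0711.4948: Lemma 14), last paragraph [Nolin2008].
* R. Diestel, *Graph Theory*, 5th ed. (2017), Thm. 3.3.1 (Menger) [Diestel2017].
-/

noncomputable section

open Set

namespace Literature.Probability.Percolation

open LatticeModels HalfAnnulus Literature.Combinatorics.SimpleGraph

namespace IntPairData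

variable {m N k₀ K T R₀ : ℕ} {ω : SiteConfig (Site 2)}


/-! ### Geometry of an attachment to an arm -/

/-- The far end of an arm is outside the `7k`-box about every term tip. [folklore] -/
theorem b_far_box (D : IntPairData m N k₀ K T R₀ ω) (i : Fin 2) {u : ℕ} {c : Finset (Site 2)} {z : Site 2}
    (hu : (intDom m).lowestSeq ω u = some (c, z)) :
    (D.b i) 0 ≤ z 0 - 7 * D.kOf hu ∨ z 0 + 7 * D.kOf hu ≤ (D.b i) 0 ∨ (D.b i) 1 ≤ z 1 - 7 * D.kOf hu ∨ z 1 + 7 * D.kOf hu ≤ (D.b i) 1 := by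
  have h1 := D.b_far i
  obtain ⟨hz0, hz1, hz2⟩ := tip_isIntJ' hu
  have h3 := D.kOf_lt hu
  by_contra h
  push Not at h
  rw [triNorm_eq_max] at h1
  simp only [lt_max_iff] at h1
  omega

/-- **An attachment site on an arm lies in the fence zone above the term**: if the fence of the
term `c` (tip `z`, scale `k`) is attached at a site `q` of the arm `i` off `c`, then `q` is off
`lower c z` and in the `3k`-box about `z` (`q` is a neighbour of the first connection site `p`:
inside, `p ∈ above c`; outside, `q` is the end of the arm, on the tip arc above `z`). [cite: Nolin2008, §4.4 Lemma 15 (proof) (arXiv 0711.4948: Lemma 14)] -/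
theorem attach_geom (D : IntPairData m N k₀ K T R₀ ω) {u : ℕ} {c : Finset (Site 2)} {z : Site 2}
    (hu : (intDom m).lowestSeq ω u = some (c, z)) (i : Fin 2) (hqA : (D.fence hu).q ∈ (D.A i).support)
    (hqc : (D.fence hu).q ∉ c) :
    (D.fence hu).q ∉ (intDom m).lower c z ∧
      (z 0 - 3 * D.kOf hu ≤ (D.fence hu).q 0 ∧ (D.fence hu).q 0 ≤ z 0 + 3 * D.kOf hu ∧
        z 1 - 3 * D.kOf hu ≤ (D.fence hu).q 1 ∧ (D.fence hu).q 1 ≤ z 1 + 3 * D.kOf hu) := by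
  set Tf := D.fence hu
  have hc := term_isCrossing hu
  obtain ⟨hz0, hz1, hz2⟩ := tip_isIntJ' hu
  have hmid := D.tip_midOf hu
  have hk2 := D.two_le_kOf hu
  have hkM := D.kOf_lt hu
  have hpF := Tf.F_subset Tf.path.left_mem
  have hpbox := intFenceSet_box hpF
  have h0 := triGraph_adj_coord Tf.adj 0
  have h1 := triGraph_adj_coord Tf.adj 1
  have hqn : (m : ℤ) ≤ triNorm Tf.q := D.norm_ge hqA
  have hbox : z 0 - 3 * D.kOf hu ≤ Tf.q 0 ∧ Tf.q 0 ≤ z 0 + 3 * D.kOf hu ∧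
      z 1 - 3 * D.kOf hu ≤ Tf.q 1 ∧ Tf.q 1 ≤ z 1 + 3 * D.kOf hu := by omega
  have hqD : Tf.q ∈ haFin m := by
    refine mem_haFin.2 ⟨by omega, hqn, ?_⟩
    rw [triNorm_eq_max]; omega
  refine ⟨?_, hbox⟩
  have habove : Tf.q ∈ (intDom m).above c z := by
    by_cases hpn : (m : ℤ) ≤ triNorm Tf.p
    · have hpa := (mem_intFenceSet_inside hpF hpn).2.1
      exact JDomain.mem_above_of_adj hpa hqD hqc Tf.adj.symm
    · rw [not_le] at hpn
      have hrow := mem_intFenceSet_beyond hpF hpn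
      have hqb : triNorm Tf.q = m := by have := triNorm_le_triNorm_add_one_of_adj Tf.adj.symm; omega
      have hqy : Tf.q = D.y i := D.clean i _ hqA hqb
      have hqO : Tf.q ∈ (intDom m).J := by rw [hqy]; exact D.y_mem_J i
      have hq0 : Tf.q 0 = m := by rw [hqy]; exact (D.y_isIntJ i).1
      have hne : Tf.q 1 ≠ z 1 := fun h => hqc (by rw [Site.eq_iff_two.2 ⟨hq0.trans hz0.symm, h⟩]; exact hc.tip_mem)
      have hq1 : z 1 ≤ Tf.q 1 := by omega
      exact hc.mem_above_of_mem_Jabove (JDomain.mem_Jabove.2 ⟨hqO, by simpa using lt_of_le_of_ne hq1 hne.symm⟩)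
  exact fun hl => (JDomain.mem_lower_iff_not_mem_above hqD).1 hl habove

/-! ### The stage lemma -/

/-- **The stage lemma.** Under the cut hypothesis for a site `zz` of the arm `i`, let `c` be the
minimal term of the other arm `j` and `w₀ ∈ c` a site of the arm `i` at or before `zz` such that
every site of `lower c` on the arm up to `zz` is at or before `w₀`. Then the arm `i` up to `zz`
meets no term before `c`. [cite: Nolin2008, §4.4 Lemma 15 (proof) (arXiv 0711.4948: Lemma 14, last paragraph)] -/
theorem prefix_disjoint_earlier (D : IntPairData m N k₀ K T R₀ ω) {zz : Site 2} (hcutz : D.IsCut zz) {i j : Fin 2} (hij : i ≠ j)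
    (hzz : zz ∈ (D.A i).support) {c : Finset (Site 2)} {z : Site 2}
    (hu : (intDom m).lowestSeq ω (D.uMin j) = some (c, z))
    {w₀ : Site 2} (hw₀c : w₀ ∈ c) (hw₀z : w₀ ∈ ((D.A i).takeUntil zz hzz).support)
    (hbetween : ∀ v ∈ ((D.A i).takeUntil zz hzz).support, v ∈ (intDom m).lower c z →
      v ∈ ((D.A i).takeUntil w₀ ((D.A i).support_takeUntil_subset_support hzz hw₀z)).support) :
    ∀ v' < D.uMin j, ∀ c' z', (intDom m).lowestSeq ω v' = some (c', z') →
      ∀ t ∈ ((D.A i).takeUntil zz hzz).support, t ∉ c' := by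
  classical
  intro v' hv' c' z' h t ht htc'
  have hw₀A : w₀ ∈ (D.A i).support := (D.A i).support_takeUntil_subset_support hzz hw₀z
  have hc'below := D.term_below_of_lt hv' h hu
  have hc'low : ∀ x ∈ c', x ∈ (intDom m).lower c z := fun x hx => JDomain.mem_lower.2 (Or.inr (hc'below hx))
  have hdisj : Disjoint c' c := D.term_disjoint_of_lt hv' h hu
  -- `zz ∉ c'`
  have hzc' : zz ∉ c' := by
    intro hz'
    have h1 := hbetween zz (SimpleGraph.Walk.end_mem_support _) (hc'low zz hz')
    by_cases hw : w₀ = zz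
    · exact Finset.disjoint_left.1 hdisj hz' (hw ▸ hw₀c)
    · exact notMem_takeUntil_of_mem_takeUntil (D.A i) hzz hw₀z hw hw₀A h1
  have htz : t ≠ zz := fun e => hzc' (e ▸ htc')
  have htA : t ∈ (D.A i).support := (D.A i).support_takeUntil_subset_support hzz ht
  -- `t`, hence all of `c'`, is reached
  have htR : t ∈ D.Reach zz := D.mem_reach_of_prefix i htA (notMem_takeUntil_of_mem_takeUntil (D.A i) hzz ht htz htA)
  have hc'R : ∀ x ∈ c', x ∈ D.Reach zz := D.term_subset_reach h hzc' htc' htR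
  -- the fence of `c'` is attached to the arm `i` at or after `zz`
  set Tf := D.fence h with hTf
  have hzF : zz ∉ Tf.F := fun hF => D.fence_disjoint_arm h hF ⟨i, hzz⟩
  have hqR : Tf.q ∉ D.Reach zz := D.q_not_reach hcutz h hzF
  have hqc' : Tf.q ∉ c' := fun hq => hqR (hc'R _ hq)
  have hqA : Tf.q ∈ (D.A i).support := by
    rcases Tf.q_mem with hq | ⟨i', hq⟩
    · exact absurd (Finset.mem_coe.1 hq) hqc'
    · by_cases hi' : i' = j
      · subst hi'
        exact absurd (D.arm_subset_reach i' (D.disj' hij hzz) _ hq) hqR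
      · rw [PairData.fin2_eq_of_ne hij hi'] at hq; exact hq
  have hzq : zz ∈ ((D.A i).takeUntil Tf.q hqA).support := by
    by_contra hno
    exact hqR (D.mem_reach_of_prefix i hqA hno)
  -- the approach of the arm `i` to the fence zone of `c'`
  obtain ⟨hqlow, hqbox⟩ := D.attach_geom h i hqA hqc'
  have hk := D.one_le_kOf h
  have hkM := D.kOf_lt h
  obtain ⟨ℓ', s', β', hℓs', γ'', hdec, hℓ'c', -, hγ''p, -, -⟩ := int_exists_last_contact (D.raw h) hk (by omega)
    (term_isCrossing h) (D.A i) (D.isPath i) (fun v hv => D.norm_ge hv) (fun v hv => D.mem_omega hv) (D.b_far_box i h)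
    hqA hqbox hqlow
  have hpath : ((D.A i).takeUntil Tf.q hqA).IsPath := (D.isPath i).takeUntil _
  have hzℓ' : zz ≠ ℓ' := fun e => hzc' (e ▸ hℓ'c')
  -- position of `zz` in the splitting
  have hzpos := (SimpleGraph.Walk.mem_support_append_iff _ _).1 (hdec ▸ hzq)
  rcases hzpos with hzβ | hzγ
  · -- `zz` before `ℓ'`: then `ℓ'`, reached, is joined to `q` off `zz`
    have hzr : zz ∉ (SimpleGraph.Walk.cons hℓs' γ'').support := fun hz2 => by
      rcases ((mem_support_right_iff hpath hdec).1 hz2).2 with h' | h'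
      · exact h' hzβ
      · exact hzℓ' h'
    have hsub : ∀ v ∈ (SimpleGraph.Walk.cons hℓs' γ'').support, v ∈ D.Aset \ {zz} := fun v hv => by
      have hv' : v ∈ ((D.A i).takeUntil Tf.q hqA).support := by
        rw [hdec, SimpleGraph.Walk.mem_support_append_iff]; exact Or.inr hv
      exact ⟨D.armSet_subset_Aset (D.mem_armSet ((D.A i).support_takeUntil_subset_support hqA hv')), fun e => hzr (e ▸ hv)⟩
    have hp : PathIn triGraph (D.Aset \ {zz}) ℓ' Tf.q :=
      (PathIn.of_walk_mem_support (SimpleGraph.Walk.cons hℓs' γ'') hsub (SimpleGraph.Walk.end_mem_support _)).1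
    exact hqR (D.reach_of_pathIn (hc'R ℓ' hℓ'c') hp)
  · -- `zz` at or after `ℓ'`
    rw [SimpleGraph.Walk.support_cons, List.mem_cons] at hzγ
    rcases hzγ with hz1 | hzγ
    · exact hzℓ' hz1
    -- `w₀` is at or before `zz`, hence in the splitting too
    have hw₀q : w₀ ∈ ((D.A i).takeUntil Tf.q hqA).support := support_takeUntil_subset_of_mem (D.A i) hqA hzq hw₀z
    have hw₀ℓ' : w₀ ≠ ℓ' := fun e => Finset.disjoint_left.1 hdisj hℓ'c' (e ▸ hw₀c)
    rcases (SimpleGraph.Walk.mem_support_append_iff _ _).1 (hdec ▸ hw₀q) with hwβ | hwγ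
    · -- `w₀` before `ℓ'`: but `ℓ' ∈ lower c` lies before `zz`, hence before `w₀` — contradiction
      have hβeq : β' = ((D.A i).takeUntil Tf.q hqA).takeUntil ℓ' (hdec ▸ (SimpleGraph.Walk.mem_support_append_iff _ _).2 (Or.inl β'.end_mem_support)) :=
        prefix_eq_takeUntil hpath hdec _
      have hℓ'A : ℓ' ∈ (D.A i).support := (D.A i).support_takeUntil_subset_support hqA
        (hdec ▸ (SimpleGraph.Walk.mem_support_append_iff _ _).2 (Or.inl β'.end_mem_support))
      have hw₀ℓ : w₀ ∈ ((D.A i).takeUntil ℓ' hℓ'A).support := by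
        have : ((D.A i).takeUntil Tf.q hqA).takeUntil ℓ' (hdec ▸ (SimpleGraph.Walk.mem_support_append_iff _ _).2 (Or.inl β'.end_mem_support)) =
            (D.A i).takeUntil ℓ' hℓ'A := SimpleGraph.Walk.takeUntil_takeUntil _ _ _
        rw [← this, ← hβeq]; exact hwβ
      -- `ℓ'` is at or before `zz`: otherwise `zz ∈ takeUntil ℓ' = β'`, but `zz ∈ γ''`
      have hℓ'z : ℓ' ∈ ((D.A i).takeUntil zz hzz).support := by
        rcases mem_takeUntil_or (D.A i) hzz hℓ'A with h' | h'
        · exact h'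
        · exfalso
          have : ((D.A i).takeUntil Tf.q hqA).takeUntil ℓ' (hdec ▸ (SimpleGraph.Walk.mem_support_append_iff _ _).2 (Or.inl β'.end_mem_support)) =
              (D.A i).takeUntil ℓ' hℓ'A := SimpleGraph.Walk.takeUntil_takeUntil _ _ _
          have hzβ' : zz ∈ β'.support := by rw [hβeq, this]; exact h'
          rcases ((mem_support_right_iff hpath hdec).1 (List.mem_cons_of_mem _ hzγ)).2 with h'' | h''
          · exact h'' hzβ'
          · exact hzℓ' h''
      have h2 := hbetween ℓ' hℓ'z (hc'low ℓ' hℓ'c')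
      exact notMem_takeUntil_of_mem_takeUntil (D.A i) hℓ'A hw₀ℓ hw₀ℓ' hw₀A h2
    · rw [SimpleGraph.Walk.support_cons, List.mem_cons] at hwγ
      rcases hwγ with hw1 | hwγ
      · exact hw₀ℓ' hw1
      -- `w₀` on the piece off `lower c'` inside the `7k'`-box: the outer ring excludes `w₀ ∈ c`
      obtain ⟨-, -, -, hbox⟩ := hγ''p w₀ hwγ
      exact int_not_mem_of_box7_offLower (D.raw h) hk hkM (term_isCrossing h)
        (term_isCrossing hu) (term_open hu) (D.term_offLower_of_lt hv' h hu) hbox hw₀c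

/-! ### The entry piece and the components, as good sets -/

/-- **The entry piece of the arm `i` at `zz`, as a good set.** For a site `zz` of the arm `i`
(a half-annulus site) such that the arm up to `zz` avoids the terms before `c = c_{u_j}` (`j ≠ i`), the
piece inside the half-annulus ending at `zz` is a good set for `j` starting on the start set,
containing `zz`, made of sites of the arm up to `zz`, meeting the tip arc at most at `zz`. [folklore] -/
theorem exists_entry_goodSet (D : IntPairData m N k₀ K T R₀ ω) {i j : Fin 2} (hij : i ≠ j) {zz : Site 2}
    (hzz : zz ∈ (D.A i).support) (hz0 : zz ∈ haFin m)
    (hstage : ∀ v' < D.uMin j, ∀ c' z', (intDom m).lowestSeq ω v' = some (c', z') →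
      ∀ t ∈ ((D.A i).takeUntil zz hzz).support, t ∉ c') :
    ∃ P : Set (Site 2), D.GoodSet j P ∧ (∃ f ∈ P, f ∈ (intDom m).F) ∧ zz ∈ P ∧
      (∀ v ∈ P, v ∈ ((D.A i).takeUntil zz hzz).support) ∧ (∀ v ∈ P, v ∈ (intDom m).J → v = zz) := by
  classical
  obtain ⟨f, β, γ, -, hfI, -, hγD, hγsub⟩ := int_exists_entry_subwalk (D.A i) (D.isPath i) (fun v hv => D.norm_ge hv)
    (D.b_far i) hzz (mem_haFin.1 hz0).1 (mem_haFin.1 hz0).2.2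
  have hA : ∀ v ∈ γ.support, v ∈ (D.A i).support := fun v hv => (D.A i).support_takeUntil_subset_support hzz (hγsub v hv)
  refine ⟨{v | v ∈ γ.support}, ?_, ⟨f, γ.start_mem_support, hfI⟩, γ.end_mem_support, hγsub, fun v hv hvO => ?_⟩
  · exact
      { sub_D := fun v hv => Finset.mem_coe.2 (hγD v hv)
        sub_ω := fun v hv => D.mem_omega (hA v hv)
        conn := siteConn_walk γ
        avoid := fun v hv hvα => D.disj' hij (hA v hv) (D.αF_subset j v hvα)
        stage := fun v' hv' c' z' h v hv => hstage v' hv' c' z' h v (hγsub v hv) }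
  · -- a tip-arc site on the arm is its end, which lies in the prefix up to `zz` only if it is `zz`
    have hvA := hA v hv
    have hvn : triNorm v = m := by
      obtain ⟨h0, h1, h2⟩ := (mem_intDom_J.1 hvO).2
      rw [triNorm_eq_max]; omega
    have hvy : v = D.y i := D.clean i v hvA hvn
    by_contra hne
    have := notMem_takeUntil_of_mem_takeUntil (D.A i) hzz (hγsub v hv) hne hvA
    subst hvy
    rw [takeUntil_end_eq_self (D.A i) (D.isPath i)] at this
    exact this hzz

/-- **The component of an unreached site of `c` off `zz`, as a good set**, not reached, adjacent
to `zz ∈ c`. [folklore] -/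
theorem exists_comp_goodSet (D : IntPairData m N k₀ K T R₀ ω) {zz : Site 2} {j : Fin 2}
    {c : Finset (Site 2)} {z : Site 2} (hu : (intDom m).lowestSeq ω (D.uMin j) = some (c, z))
    (hzc : zz ∈ c) {a₀ : Site 2} (ha₀ : a₀ ∈ c) (ha₀z : a₀ ≠ zz) (ha₀R : a₀ ∉ D.Reach zz)
    (hαR : ∀ v ∈ D.αF j, v ∈ D.Reach zz) :
    ∃ L : Set (Site 2), D.GoodSet j L ∧ a₀ ∈ L ∧ L ⊆ (↑c : Set (Site 2)) \ {zz} ∧ (∀ v ∈ L, v ∉ D.Reach zz) ∧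
      ∃ a ∈ L, triGraph.Adj zz a := by
  have hc := term_isCrossing hu
  set L := siteComp ((↑c : Set (Site 2)) \ {zz}) a₀ with hL
  have ha₀L : a₀ ∈ L := mem_siteComp_self ⟨Finset.mem_coe.2 ha₀, ha₀z⟩
  have hLsub : L ⊆ (↑c : Set (Site 2)) \ {zz} := siteComp_subset _ _
  have hLR : ∀ v ∈ L, v ∉ D.Reach zz := fun v hv hvR =>
    ha₀R (D.reach_of_pathIn hvR ((siteConn_siteComp _ _ v hv a₀ ha₀L).mono fun w hw =>
      ⟨D.term_subset_Aset hu (hLsub hw).1, (hLsub hw).2⟩))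
  refine ⟨L, ?_, ha₀L, hLsub, hLR, ?_⟩
  · exact
      { sub_D := fun v hv => Finset.mem_coe.2 (hc.subset (hLsub hv).1)
        sub_ω := fun v hv => term_open hu (hLsub hv).1
        conn := siteConn_siteComp _ _
        avoid := fun v hv hvα => hLR v hv (hαR v hvα)
        stage := fun v' hv' c' z' h v hv hvc' => Finset.disjoint_left.1 (D.term_disjoint_of_lt hv' h hu) hvc' (hLsub hv).1 }
  · obtain ⟨a, b, -, hb, -, hab, hpa⟩ := (hc.conn a₀ ha₀ zz hzc).exit (R := {v : Site 2 | v ≠ zz}) ha₀z (fun h => h rfl)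
    have hb' : b = zz := by simpa using hb
    subst hb'
    exact ⟨a, hpa.mono fun w hw => ⟨hw.2, hw.1⟩, hab.symm⟩

/-! ### The theorem -/

/-- **A site of an arm is not a cut.** [cite: Nolin2008, §4.4 Lemma 15 (proof) (arXiv 0711.4948: Lemma 14, last paragraph)] -/
theorem not_isCut_of_mem_arm (D : IntPairData m N k₀ K T R₀ ω) {zz : Site 2} {i : Fin 2} (hzz : zz ∈ (D.A i).support) :
    ¬ D.IsCut zz := by
  classical
  intro hcutz
  -- the other arm, its minimal term, the fence
  obtain ⟨j, hij⟩ : ∃ j : Fin 2, i ≠ j := ⟨i + 1, by fin_cases i <;> decide⟩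
  obtain ⟨c, z, hu, hmeet⟩ := D.uMin_spec j
  have hc := term_isCrossing hu
  have hzO := hc.tip_mem_J
  set Tf := D.fence hu with hTf
  have hzF : zz ∉ Tf.F := fun hF => D.fence_disjoint_arm hu hF ⟨i, hzz⟩
  have hqR : Tf.q ∉ D.Reach zz := D.q_not_reach hcutz hu hzF
  have hzAj : zz ∉ (D.A j).support := D.disj' hij hzz
  have hAjR : ∀ x ∈ (D.A j).support, x ∈ D.Reach zz := D.arm_subset_reach j hzAj
  obtain ⟨x, hx⟩ := hmeet
  rw [Finset.mem_inter] at hx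
  have hxR : x ∈ D.Reach zz := hAjR x (D.αF_subset j x hx.1)
  have hαR : ∀ v ∈ D.αF j, v ∈ D.Reach zz := fun v hv => hAjR v (D.αF_subset j v hv)
  -- a tip-arc site of `c` is `z`; a tip-arc site of the arm `i` is `y i`
  have hcO : ∀ v ∈ c, v ∈ (intDom m).J → v = z := fun v hv hvO => hc.eq_tip v hv hvO
  ------------------------------------------------------------------
  -- CASE 1: `zz ∈ c` and an unreached site `a₀ ∈ c` adjacent-or-equal situation: the common sub-argument
  have case_c : zz ∈ c → ∀ a₀ ∈ c, a₀ ∉ D.Reach zz →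
      (∀ S : Set (Site 2), D.GoodSet j S → (∃ f ∈ S, f ∈ (intDom m).F) → zz ∈ S → a₀ ∈ S →
        (∀ v ∈ S, v ∈ (intDom m).J → v = z) → False) → False := by
    intro hzc a₀ ha₀ ha₀R hfinish
    have hz0 : zz ∈ haFin m := hc.subset hzc
    have hstage := D.prefix_disjoint_earlier hcutz hij hzz hu hzc (SimpleGraph.Walk.end_mem_support _) (fun v hv _ => by
      simpa using hv)
    obtain ⟨P, hP, hPf, hzP, hPsub, hPO⟩ := D.exists_entry_goodSet hij hzz hz0 hstage
    have hPO' : ∀ v ∈ P, v ∈ (intDom m).J → v = z := fun v hv hvO => by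
      have h1 := hPO v hv hvO; subst h1; exact hcO v hzc hvO
    by_cases ha₀z : a₀ = zz
    · subst ha₀z; exact hfinish P hP hPf hzP hzP hPO'
    · obtain ⟨L, hL, ha₀L, hLsub, -, a, haL, hadj⟩ := D.exists_comp_goodSet hu hzc ha₀ ha₀z ha₀R hαR
      refine hfinish (P ∪ L) (hP.union_of_link hL hzP haL (Or.inr hadj)) ?_ (Or.inl hzP) (Or.inr ha₀L) ?_
      · obtain ⟨f, hf, hfI⟩ := hPf; exact ⟨f, Or.inl hf, hfI⟩
      · rintro v (hv | hv) hvO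
        · exact hPO' v hv hvO
        · exact hcO v (hLsub hv).1 hvO
  -- with `a₀ = q ∈ c`: finish by `false_of_tip_mem` / `false_of_fence`
  have finish_q : ∀ S : Set (Site 2), D.GoodSet j S → (∃ f ∈ S, f ∈ (intDom m).F) → zz ∈ S → Tf.q ∈ S →
      (∀ v ∈ S, v ∈ (intDom m).J → v = z) → zz ∈ c → False := by
    intro S hS hSf hzS hqS hSO hzc
    by_cases hzS' : z ∈ S
    · exact hS.false_of_tip_mem hu hSf hzS' hSO
    · exact hS.false_of_fence hu hSf (fun v hv hvO => hzS' ((hSO v hv hvO) ▸ hv)) hzS hzc hqS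
  ------------------------------------------------------------------
  rcases Tf.q_mem with hqc | ⟨i', hqA⟩
  · -- attached to the term: `zz ∈ c` (else `c`, reached through `x`, would contain the unreached `q`)
    have hqc' : Tf.q ∈ c := Finset.mem_coe.1 hqc
    have hzc : zz ∈ c := by
      by_contra hzc; exact hqR (D.term_subset_reach hu hzc hx.2 hxR _ hqc')
    exact case_c hzc Tf.q hqc' hqR fun S hS hSf hzS hqS hSO => finish_q S hS hSf hzS hqS hSO hzc
  -- attached to an arm: not the arm `j` (reached)
  by_cases hi' : i' = j
  · subst hi'; exact hqR (hAjR _ hqA)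
  rw [PairData.fin2_eq_of_ne hij hi'] at hqA
  by_cases hqc : Tf.q ∈ c
  · have hzc : zz ∈ c := by
      by_contra hzc; exact hqR (D.term_subset_reach hu hzc hx.2 hxR _ hqc)
    exact case_c hzc Tf.q hqc hqR fun S hS hSf hzS hqS hSO => finish_q S hS hSf hzS hqS hSO hzc
  ------------------------------------------------------------------
  -- CASE 2: attached to the arm `i` off `c`, at or after `zz`
  have hzq : zz ∈ ((D.A i).takeUntil Tf.q hqA).support := by
    by_contra hno; exact hqR (D.mem_reach_of_prefix i hqA hno)
  obtain ⟨hqlow, hqbox⟩ := D.attach_geom hu i hqA hqc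
  have hk := D.one_le_kOf hu
  have hkM := D.kOf_lt hu
  obtain ⟨ℓ, s, β, hℓs, γ', hdec, hℓc, -, hγ'p, -, hℓmem⟩ := int_exists_last_contact (D.raw hu) hk
    (by omega) hc (D.A i) (D.isPath i) (fun v hv => D.norm_ge hv) (fun v hv => D.mem_omega hv)
    (D.b_far_box i hu) hqA hqbox hqlow
  have hpath : ((D.A i).takeUntil Tf.q hqA).IsPath := (D.isPath i).takeUntil _
  have hℓq : ℓ ∈ ((D.A i).takeUntil Tf.q hqA).support := hℓmem
  have hℓA : ℓ ∈ (D.A i).support := (D.A i).support_takeUntil_subset_support hqA hℓq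
  have hβeq : β = ((D.A i).takeUntil Tf.q hqA).takeUntil ℓ hℓq := prefix_eq_takeUntil hpath hdec hℓq
  have htakeℓ : ((D.A i).takeUntil Tf.q hqA).takeUntil ℓ hℓq = (D.A i).takeUntil ℓ hℓA := SimpleGraph.Walk.takeUntil_takeUntil _ _ _
  have hβsupp : ∀ v, v ∈ β.support ↔ v ∈ ((D.A i).takeUntil ℓ hℓA).support := fun v => by rw [hβeq, htakeℓ]
  have hright : ∀ v, v ∈ (SimpleGraph.Walk.cons hℓs γ').support ↔ v ∈ ((D.A i).takeUntil Tf.q hqA).support ∧ (v ∉ β.support ∨ v = ℓ) :=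
    fun v => mem_support_right_iff hpath hdec
  have hℓγ' : ℓ ∉ γ'.support := ((SimpleGraph.Walk.cons_isPath_iff hℓs γ').1 ((isPath_append_iff'.1 (hdec ▸ hpath)).2.1)).2
  -- the piece `seg = ℓ … q` as a good set
  set seg : Set (Site 2) := {v | v ∈ (SimpleGraph.Walk.cons hℓs γ').support} with hseg
  have hsegq : ∀ v ∈ seg, v ∈ ((D.A i).takeUntil Tf.q hqA).support := fun v hv => ((hright v).1 hv).1
  have hsegA : ∀ v ∈ seg, v ∈ (D.A i).support := fun v hv => (D.A i).support_takeUntil_subset_support hqA (hsegq v hv)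
  have hseg_cases : ∀ v ∈ seg, v = ℓ ∨ v ∈ γ'.support := fun v hv => by
    rw [hseg, Set.mem_setOf_eq, SimpleGraph.Walk.support_cons, List.mem_cons] at hv; exact hv
  have hsegGood : D.GoodSet j seg :=
    { sub_D := fun v hv => by
        rcases hseg_cases v hv with h | h
        · subst h; exact Finset.mem_coe.2 (hc.subset hℓc)
        · exact Finset.mem_coe.2 (hγ'p v h).2.1
      sub_ω := fun v hv => D.mem_omega (hsegA v hv)
      conn := siteConn_walk _
      avoid := fun v hv hvα => D.disj' hij (hsegA v hv) (D.αF_subset j v hvα)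
      stage := fun v' hv' c' z' h v hv hvc' => by
        rcases hseg_cases v hv with h' | h'
        · subst h'; exact Finset.disjoint_left.1 (D.term_disjoint_of_lt hv' h hu) hvc' hℓc
        · exact (hγ'p v h').1 (JDomain.mem_lower.2 (Or.inr (D.term_below_of_lt hv' h hu hvc'))) }
  have hqseg : Tf.q ∈ seg := SimpleGraph.Walk.end_mem_support _
  have hℓseg : ℓ ∈ seg := SimpleGraph.Walk.start_mem_support _
  -- a tip-arc site of the arm `i` up to `q` is the end `y i`, and then `q = y i`
  have hOq : ∀ v ∈ ((D.A i).takeUntil Tf.q hqA).support, v ∈ (intDom m).J → v = D.y i ∧ Tf.q = D.y i := by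
    intro v hv hvO
    have hvA := (D.A i).support_takeUntil_subset_support hqA hv
    have hvn : triNorm v = m := by
      obtain ⟨h0', h1', h2'⟩ := (mem_intDom_J.1 hvO).2
      rw [triNorm_eq_max]; omega
    have hvy : v = D.y i := D.clean i v hvA hvn
    refine ⟨hvy, ?_⟩
    by_contra hne
    have := notMem_takeUntil_of_mem_takeUntil (D.A i) hqA hv (fun e => hne (by rw [← e, hvy])) hvA
    subst hvy
    rw [takeUntil_end_eq_self (D.A i) (D.isPath i)] at this
    exact this hqA
  have hsegO : ∀ v ∈ seg, v ∈ (intDom m).J → (v = ℓ ∧ ℓ = z) ∨ (v = Tf.q ∧ Tf.q = D.y i) := by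
    intro v hv hvO
    obtain ⟨hvy, hqy⟩ := hOq v (hsegq v hv) hvO
    rcases hseg_cases v hv with h | h
    · exact Or.inl ⟨h, hcO ℓ hℓc (h ▸ hvO)⟩
    · exact Or.inr ⟨by rw [hvy, hqy], hqy⟩
  -- if `q = y i` lies above the tip of `α_j`: Lemma A with `seg` alone
  have hq_high : Tf.q = D.y i → (D.y j) 1 < (D.y i) 1 → False := fun hqy hlt =>
    hsegGood.not_mem_term hu hqseg (Finset.mem_union_right _ (JDomain.mem_Jabove.2 ⟨hqy ▸ D.y_mem_J i, by simpa [hqy] using hlt⟩))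
      ℓ hℓseg hℓc
  have hyne : (D.y i) 1 ≠ (D.y j) 1 := fun h => D.y_ne hij (Site.eq_iff_two.2 ⟨(D.y_isIntJ i).1.trans (D.y_isIntJ j).1.symm, h⟩)
  -- the dispatcher: a good set `S` (from the start set, tip-arc sites `= z`, `z ∉ S`) sharing a site with `seg`,
  -- with a `c`-site in `S ∪ seg`, is impossible when `ℓ ≠ z`
  have dispatch : ℓ ≠ z → ∀ S : Set (Site 2), D.GoodSet j S → (∃ f ∈ S, f ∈ (intDom m).F) →
      (∀ v ∈ S, v ∈ (intDom m).J → v = z ∨ (v = Tf.q ∧ Tf.q = D.y i)) → z ∉ S → (∃ a ∈ S, a ∈ seg) →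
      (∃ w₀ ∈ S ∪ seg, w₀ ∈ c) → False := by
    intro hℓz S hS hSf hSO hzS ⟨a, haS, haseg⟩ ⟨w₀, hw₀, hw₀c⟩
    have hS' : D.GoodSet j (S ∪ seg) := hS.union_of_link hsegGood haS haseg (Or.inl rfl)
    have hSf' : ∃ f ∈ S ∪ seg, f ∈ (intDom m).F := by obtain ⟨f, hf, hfI⟩ := hSf; exact ⟨f, Or.inl hf, hfI⟩
    have hO' : ∀ v ∈ S ∪ seg, v ∈ (intDom m).J → v = Tf.q ∧ Tf.q = D.y i := by
      rintro v (hv | hv) hvO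
      · rcases hSO v hv hvO with h | h
        · exact absurd (h ▸ hv) hzS
        · exact h
      · rcases hsegO v hv hvO with ⟨-, h2⟩ | h2
        · exact absurd h2 hℓz
        · exact h2
    by_cases hqy : Tf.q = D.y i
    · rcases lt_or_gt_of_ne hyne with hlt | hlt
      · exact hS'.false_of_tip hu hSf' (Or.inr hqseg) (hqy ▸ D.y_mem_J i) (fun v hv hvO => (hO' v hv hvO).1) (hqy ▸ hlt)
      · exact hq_high hqy hlt
    · exact hS'.false_of_fence hu hSf' (fun v hv hvO => hqy (hO' v hv hvO).2) hw₀ hw₀c (Or.inr hqseg)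
  -- `ℓ` is joined to `q` along `seg`; if `zz ∉ seg` this runs off `zz`
  have hℓq_path : zz ∉ seg → PathIn triGraph (D.Aset \ {zz}) ℓ Tf.q := fun hzseg =>
    (PathIn.of_walk_mem_support (SimpleGraph.Walk.cons hℓs γ') (A := D.Aset \ {zz})
      (fun v hv => ⟨D.armSet_subset_Aset (D.mem_armSet (hsegA v hv)), fun e => hzseg (e ▸ hv)⟩) (SimpleGraph.Walk.end_mem_support _)).1
  ------------------------------------------------------------------
  -- position of `zz` in `takeUntil q = β ++ (ℓ :: γ')`
  by_cases hzℓ : zz = ℓ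
  · -- `zz = ℓ ∈ c`
    subst hzℓ
    refine case_c hℓc zz hℓc (fun h => (D.reach_subset h).2 rfl) fun S hS hSf hzS _ hSO => ?_
    by_cases hzS' : z ∈ S
    · exact hS.false_of_tip_mem hu hSf hzS' hSO
    · have hℓz : zz ≠ z := fun e => hzS' (e ▸ hzS)
      exact dispatch hℓz S hS hSf (fun v hv hvO => Or.inl (hSO v hv hvO)) hzS' ⟨zz, hzS, hℓseg⟩ ⟨zz, Or.inl hzS, hℓc⟩
  rcases (SimpleGraph.Walk.mem_support_append_iff _ _).1 (hdec ▸ hzq) with hzβ | hzγ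
  · ----------------------------------------------------------------
    -- `zz` strictly before `ℓ`: `zz ∉ seg`, so `ℓ` unreached (else `q` reached); hence `zz ∈ c`
    have hzseg : zz ∉ seg := fun hz2 => by
      rcases ((hright zz).1 hz2).2 with h' | h'
      · exact h' hzβ
      · exact hzℓ h'
    have hℓR : ℓ ∉ D.Reach zz := fun h => hqR (D.reach_of_pathIn h (hℓq_path hzseg))
    have hzc : zz ∈ c := by
      by_contra hzc; exact hℓR (D.term_subset_reach hu hzc hx.2 hxR ℓ hℓc)
    refine case_c hzc ℓ hℓc hℓR fun S hS hSf hzS hℓS hSO => ?_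
    by_cases hzS' : z ∈ S
    · exact hS.false_of_tip_mem hu hSf hzS' hSO
    · have hℓz : ℓ ≠ z := fun e => hzS' (e ▸ hℓS)
      exact dispatch hℓz S hS hSf (fun v hv hvO => Or.inl (hSO v hv hvO)) hzS' ⟨ℓ, hℓS, hℓseg⟩ ⟨ℓ, Or.inl hℓS, hℓc⟩
  · ----------------------------------------------------------------
    -- `zz` after `ℓ`, on the piece off `lower c`
    have hzγ' : zz ∈ γ'.support := by
      rw [SimpleGraph.Walk.support_cons, List.mem_cons] at hzγ
      rcases hzγ with h | h
      · exact absurd h hzℓ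
      · exact h
    have hzseg : zz ∈ seg := List.mem_cons_of_mem _ hzγ'
    obtain ⟨hzlow, hzD, -, -⟩ := hγ'p zz hzγ'
    -- `ℓ` is at or before `zz`
    have hℓz : ℓ ∈ ((D.A i).takeUntil zz hzz).support := by
      rcases mem_takeUntil_or (D.A i) hzz hℓA with h | h
      · exact h
      · exfalso
        have hzβ : zz ∈ β.support := (hβsupp zz).2 h
        rcases ((hright zz).1 hzseg).2 with h' | h'
        · exact h' hzβ
        · exact hzℓ h'
    -- every `lower c`-site of the arm up to `zz` is at or before `ℓ`
    have hbetween : ∀ v ∈ ((D.A i).takeUntil zz hzz).support, v ∈ (intDom m).lower c z →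
        v ∈ ((D.A i).takeUntil ℓ ((D.A i).support_takeUntil_subset_support hzz hℓz)).support := by
      intro v hv hvl
      have hvq : v ∈ ((D.A i).takeUntil Tf.q hqA).support := support_takeUntil_subset_of_mem (D.A i) hqA hzq hv
      rcases (SimpleGraph.Walk.mem_support_append_iff _ _).1 (hdec ▸ hvq) with hvβ | hvγ
      · exact (hβsupp v).1 hvβ
      · rw [SimpleGraph.Walk.support_cons, List.mem_cons] at hvγ
        rcases hvγ with h | h
        · subst h; exact SimpleGraph.Walk.end_mem_support _
        · exact absurd hvl (hγ'p v h).1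
    have hstage := D.prefix_disjoint_earlier hcutz hij hzz hu hℓc hℓz hbetween
    by_cases hℓz' : ℓ = z
    · -- the arm passes through the tip of `c` before `zz`: the entry piece at `ℓ` is a crossing with tip `z`
      have hℓ0 : ℓ ∈ haFin m := hc.subset hℓc
      have hstageℓ : ∀ v' < D.uMin j, ∀ c' z', (intDom m).lowestSeq ω v' = some (c', z') →
          ∀ t ∈ ((D.A i).takeUntil ℓ hℓA).support, t ∉ c' := fun v' hv' c' z' h t ht =>
        hstage v' hv' c' z' h t (support_takeUntil_subset_of_mem (D.A i) hzz hℓz ht)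
      obtain ⟨P, hP, hPf, hℓP, -, hPO⟩ := D.exists_entry_goodSet hij hℓA hℓ0 hstageℓ
      exact hP.false_of_tip_mem hu hPf (hℓz' ▸ hℓP) (fun v hv hvO => (hPO v hv hvO).trans hℓz')
    · obtain ⟨P, hP, hPf, hzP, hPsub, hPO⟩ := D.exists_entry_goodSet hij hzz hzD hstage
      have hzc : zz ∉ c := fun h => hzlow (JDomain.mem_lower.2 (Or.inl h))
      have hPO' : ∀ v ∈ P, v ∈ (intDom m).J → v = z ∨ (v = Tf.q ∧ Tf.q = D.y i) := fun v hv hvO => by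
        -- a tip-arc site of `P` is `zz ∈ seg`: use `hsegO`
        have h1 := hPO v hv hvO
        subst h1
        rcases hsegO v hzseg hvO with ⟨h2, -⟩ | h2
        · exact absurd h2 hzℓ
        · exact Or.inr h2
      have hzP' : z ∉ P := fun h => hzc (by rw [← hPO z h hzO]; exact hc.tip_mem)
      exact dispatch hℓz' P hP hPf hPO' hzP' ⟨zz, hzP, hzseg⟩ ⟨ℓ, Or.inr hℓseg, hℓc⟩

end IntPairData

end Literature.Probability.Percolation
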